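import Summits.BirchSwinnertonDyer.BirchSwinnertonDyer.Theorems.EdixhovenFibreFiveSevenStarredOptimalManinUnitFiveSevenLocalFormulaSupersingularCellsNumerology
import HarnessLib

/-!
# STUB `stub_localFormulaSupersingularCells` of skeleton v10 — PROVED (route `EdixhovenFibreFiveSeven`, crux K★ stmt-BirchSwinnertonDyer-22226,
# line `kato-lever`; seat `bsd-line-edix-p1` g30, LEAD)

HONEST FRAMING. One theorem (no definition, no named fact, no instance, no `sorry`): the registered stub `stub_localFormulaSupersingularCells` of skeleton v10
(`Cruxes/StarredOptimalManinUnitFiveSeven/Lines/kato_lever.lean`) BY NAME AND SIGNATURE — Kato's explicit reciprocity FORMULA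
`⟨[η″], P′⟩ = Tr_{K_{v′}/ℚ_p}(c′ · exp*_{d″}(η″) · log_{ω′} P′)` (`∀ d″ ∃ c′`) for the DIRECT representation of every globally minimal `W′/ℚ` IN the potentially
supersingular K★ cells `(5; IV*), (5; II*), (7; III*)` over the completion `K_{v′}` of ANY number field `K ∋ p^{1/e}` at ANY place `v′ ∋ p`, for every compatible
`ω′`, every ALTERNATING Weil tower of `W′` and the Prop-1.2.3 binders handed over. Proof: `…LocalFormulaSupersingularCellsNumerology.localFormula_of_numerology` (the
(K₂)^ram road of the line — T5-A…F / E3–E6 by edix-p4, the CM-fibre transport and the transported Hodge line by the LEAD lineage — at the cell numerology of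
`…SupersingularCellsModels` / `…GoodModelFormula`). The crux K★ stays OPEN ⟸ {P1-bar `stub_sl2NeronValues`, DD `stub_dokchitserDokchitser`,
`stub_localFormulaOrdinaryCells`}; BSD is not proved by any of this.

References: [Kato1993LNM1553] Ch. II Thm. 1.4.1 (3)–(4), Lemma 1.4.3–1.4.5, §1.2.4; [BlochKato1990] Prop. 3.8, Example 3.11; [SilvermanATAEC1994] IV Table 4.1.
-/

set_option autoImplicit false
-- single-conjunct summit: `Summit.BirchSwinnertonDyer.BirchSwinnertonDyer.…` repeats the name by design
set_option linter.dupNamespace false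

noncomputable section

open Field Function ValuativeRel WittVector NumberField IsDedekindDomain Polynomial
open scoped NumberField Topology Classical NNReal
open Literature.NumberTheory.PAdicHodge Literature.NumberTheory.GaloisRepresentations
  Literature.NumberTheory.GaloisRepresentations.IsNonarchimedeanLocalField Literature.NumberTheory.GaloisRepresentations.LubinTate
  Literature.NumberTheory.GaloisCohomology Literature.NumberTheory.EllipticCurves Literature.NumberTheory.EllipticCurves.FormalGroupChart
  Literature.NumberTheory.PAdicHodge.GaloisContinuity Literature.IUT.LogVolume Literature.RingTheory.FormalGroups
  Literature.AlgebraicGeometry.Resolution _root_.WeierstrassCurve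
  Literature.NumberTheory.EllipticCurves.Rank1Residual Literature.NumberTheory.DiophantineGeometry Rat.HeightOneSpectrum
  Summit.BirchSwinnertonDyer.Rank1Residual Summit.BirchSwinnertonDyer.Rank1Residual.Additive
  Summit.BirchSwinnertonDyer.BirchSwinnertonDyer.Theorems.StarredOptimalManinUnitFiveSevenLocalFormulaSupersingularCellsNumerology

namespace Summit.BirchSwinnertonDyer.BirchSwinnertonDyer.Theorems.StarredOptimalManinUnitFiveSevenLocalFormulaSupersingularCells

/-- ★★★★ **STUB `stub_localFormulaSupersingularCells` OF SKELETON v10, PROVED** — Kato's explicit reciprocity FORMULA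
`⟨[η″], P′⟩ = Tr_{K_{v′}/ℚ_p}(c′ · exp*_{d″}(η″) · log_{ω′} P′)` (`∀ d″ ∃ c′`) for the DIRECT representation `V_pW′|_{Γ_{K_{v′}}}` of every globally minimal `W′/ℚ`
IN the potentially supersingular K★ cells `(5; IV*), (5; II*), (7; III*)`, over the completion `K_{v′}` of ANY number field `K ∋ p^{1/e}` (cell table) at ANY
place `v′ ∋ p`, for every compatible `ω′`, every ALTERNATING Weil tower of `W′` and the Prop-1.2.3 binders of the direct representation
(`localFormula_of_numerology` by the cell table, numerology as in `…GoodModelFormula.exists_goodModel_formula_of_ssCell`).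
[cite: Kato1993LNM1553, Ch. II Thm. 1.4.1 (3)–(4), Lemma 1.4.3–1.4.5 and §1.2.4] [cite: BlochKato1990, Prop. 3.8 (p. 354), Example 3.11 (p. 361)]
[cite: SilvermanATAEC1994, IV Table 4.1] -/
theorem stub_localFormulaSupersingularCells :
    ∀ (W' : WeierstrassCurve ℚ) [W'.IsElliptic] [W'.IsGloballyMinimal] (p : ℕ) [Fact p.Prime], (p = 5 ∨ p = 7) → Addv W' p → Irr W' p →
      (∀ (v : HeightOneSpectrum ℤ) (n : ℕ), natGenerator v = p → W'.kodairaSymbolAt v ≠ KodairaSymbol.Istar n) →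
      4 < padicValInt p W'.minimalDiscriminantInt → ¬ (p = 5 ↔ padicValInt p W'.minimalDiscriminantInt = 9) →
      ∀ {K : Type} [Field K] [NumberField K] (α : K) (e : ℕ),
      (p = 5 ∧ padicValInt p W'.minimalDiscriminantInt = 8 ∧ e = 3 ∨ p = 5 ∧ padicValInt p W'.minimalDiscriminantInt = 10 ∧ e = 6 ∨
        p = 7 ∧ padicValInt p W'.minimalDiscriminantInt = 9 ∧ e = 4) → α ^ e = (p : K) →
      ∀ (v' : HeightOneSpectrum (𝓞 K)) (hv' : ((p : ℕ) : 𝓞 K) ∈ v'.asIdeal)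
      [CharZero (v'.adicCompletion K)] [Fact (¬ IsUnit ((p : ℕ) : integerC (v'.adicCompletion K)))]
      [IsAdicComplete (Ideal.span {((p : ℕ) : integerC (v'.adicCompletion K))}) (integerC (v'.adicCompletion K))]
      (hp' : valuation (v'.adicCompletion K) ((p : ℕ) : (v'.adicCompletion K)) < 1)
      (ω' : Valuation (v'.adicCompletion K) ℝ≥0) [ω'.Compatible] [(W'.baseChange (v'.adicCompletion K)).IsIntegral ω'.integer],
      letI := LocalField.adicCompletionPadicAlgebra v' p hv'
      ∀ (e : (k : ℕ) → geomTorsion W' ((p ^ k : ℕ) : ℤ) → geomTorsion W' ((p ^ k : ℕ) : ℤ) → AlgebraicClosure ℚ) (hμ : ∀ k S T, e k S T ^ (p ^ k) = 1)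
      (hadd₁ : ∀ k S₁ S₂ T, e k (S₁ + S₂) T = e k S₁ T * e k S₂ T) (hadd₂ : ∀ k S T₁ T₂, e k S (T₁ + T₂) = e k S T₁ * e k S T₂)
      (hgal : ∀ k (σ : absoluteGaloisGroup ℚ) (S T : geomTorsion W' ((p ^ k : ℕ) : ℤ)), σ • e k S T = e k (σ • S) (σ • T))
      (_hnondeg : ∀ k (T : geomTorsion W' ((p ^ k : ℕ) : ℤ)), (∀ S, e k S T = 1) → T = 0) (_halt : ∀ k (S : geomTorsion W' ((p ^ k : ℕ) : ℤ)), e k S S = 1)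
      (hcompat : ∀ k (S T : geomTorsion W' ((p ^ (k + 1) : ℕ) : ℤ)),
      e k (torsionMulHom W' (p ^ (k + 1)) (p ^ k) p (pow_succ p k).symm S) (torsionMulHom W' (p ^ (k + 1)) (p ^ k) p (pow_succ p k).symm T) = e (k + 1) S T ^ p),
      (bdRPeriodRingData (F := (v'.adicCompletion K)) (p := p) hp').CupLogInjective (logCyclotomic p) (restrictedRationalTateRep W' (v'.adicCompletion K) p) →
      (∀ z : contOneCocycles (restrictedRationalTateRep W' (v'.adicCompletion K) p).toTopRep,
        (bdRPeriodRingData (F := (v'.adicCompletion K)) (p := p) hp').HasDualExp (logCyclotomic p) (restrictedRationalTateRep W' (v'.adicCompletion K) p) fun σ => z.1 σ) →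
      ∀ d'' : (bdRPeriodRingData (F := (v'.adicCompletion K)) (p := p) hp').FilZeroLine (restrictedRationalTateRep W' (v'.adicCompletion K) p), ∃ c' : (v'.adicCompletion K),
      ∀ (η'' : contOneCocycles (restrictedTateRep W' (v'.adicCompletion K) p).toTopRep) (P' : (W'.baseChange (v'.adicCompletion K)).toAffine.Point),
      ((tatePairingPoint W' (v'.adicCompletion K) p e hμ hadd₁ hadd₂ hgal hcompat (oneCocycleClass _ η'') P' : ℤ_[p]) : ℚ_[p]) =
        Algebra.trace ℚ_[p] (v'.adicCompletion K) (c' * expStarCoord W' hp' d'' η'' * padicLogPointFiniteExt ω' (W'.baseChange (v'.adicCompletion K)) p P') := by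
  intro W _ _ p hp hp57 hadd _hirr hIstar h4 _hss K _ _ α e htab hαe v' hv' _ _ _ hp' ω' _ _
  have hp5 : 5 ≤ p := by rcases hp57 with rfl | rfl <;> norm_num
  have hgen : natGenerator (placeOf p) = p := congrArg Subtype.val ((primesEquiv (R := ℤ)).apply_symm_apply ⟨p, hp.out⟩)
  obtain ⟨hj, -⟩ := padicValRat_j_nonneg_and_mem_of_starred W p hp5 hadd (fun n => hIstar (placeOf p) n hgen) h4
  rcases htab with ⟨rfl, h8, rfl⟩ | ⟨rfl, h10, rfl⟩ | ⟨rfl, h9, rfl⟩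
  · exact localFormula_of_numerology W 5 (Or.inl rfl) hj (e := 3) (k := 2) (m := 3) (n := 4) (r₄ := 1) (r₆ := 0) (t₄ := 1)
      (t₆ := 0) (by norm_num) (by norm_num) (by norm_num) (by norm_num) (by norm_num) (by rw [h8]) (by rw [h8]) (by norm_num) (by norm_num)
      (fun _ => ⟨by norm_num, by norm_num, by norm_num⟩) (fun h => by norm_num at h) (fun _ => rfl) (fun h => by norm_num at h) hαe v' hv' hp' ω'
  · exact localFormula_of_numerology W 5 (Or.inl rfl) hj (e := 6) (k := 5) (m := 4) (n := 5) (r₄ := 4) (r₆ := 0) (t₄ := 2)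
      (t₆ := 0) (by norm_num) (by norm_num) (by norm_num) (by norm_num) (by norm_num) (by rw [h10]) (by rw [h10]) (by norm_num) (by norm_num)
      (fun _ => ⟨by norm_num, by norm_num, by norm_num⟩) (fun h => by norm_num at h) (fun _ => rfl) (fun h => by norm_num at h) hαe v' hv' hp' ω'
  · exact localFormula_of_numerology W 7 (Or.inr rfl) hj (e := 4) (k := 3) (m := 3) (n := 5) (r₄ := 0) (r₆ := 2) (t₄ := 0)
      (t₆ := 1) (by norm_num) (by norm_num) (by norm_num) (by norm_num) (by norm_num) (by rw [h9]) (by rw [h9]) (by norm_num) (by norm_num)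
      (fun h => by norm_num at h) (fun _ => ⟨by norm_num, by norm_num, by norm_num⟩) (fun h => by norm_num at h) (fun _ => rfl) hαe v' hv' hp' ω'

end Summit.BirchSwinnertonDyer.BirchSwinnertonDyer.Theorems.StarredOptimalManinUnitFiveSevenLocalFormulaSupersingularCells

end
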